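import Summits.QuantumFields.BalabanUV.Beta.GAN24.FaceDataHessNull
import Summits.QuantumFields.BalabanUV.Beta.GAN24.SymVHClassCurrentSym
import Summits.QuantumFields.BalabanUV.Beta.GAN24.SymBorderGaugeLegContact

/-!
# `BalabanUV.Beta.GAN24.SymFaceDataVHNull` — binder row G-an2-4 ∕ (CONV-C), TRANSFER-III, the (III′) (C)-row's `hXF (l+1)` FACE TERMS (OWNER gan24-p1 g53's memo
# `M3-HXF-SIZING-g53.md` §1): **an1's (0.4)-SYMMETRISED BORDER LETTER `symVhSAt ρ d L` VANISHES AGAINST TWO FACE-SUPPORTED SINGLE-COORDINATE DATA, TERM BY TERM** — the sym twin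
# of leaf-06 g56's `FaceDataVHNull.vhSAt_faceData_eq_zero ∕ '` (every free leg, every `d`, every in-block root):
# `Σ'_q h(q_β)·Σ'_u s(u_ν)·symVhSAt ρ d L ν u q p (inl β) a = 0` for `h`, `s : ℤ → ℝ` supported on `{n : n % L = L − 1}`.
# leaf-04 g77's `SymVHClassCurrentSym` gives only the slot↔leg-symmetrised sum (`add_swap = 0`); the comb data's deep face words need the single current (the crossed orbit pairs
# `L_E(b;a) − L_E(a;b)` against `Θ(a;b)`), hence this file.
# (G-an2-4 CRUX TEAM (2), leaf prover `b2b-balaban-gan24-formalise-leaf-01`, gen 88; journal [LEAF01-G88-INTENT-1])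

THE MECHANISM (no pair-loop combinatorics).  The face weight `h(q_β)` on the FLUCTUATION leg `(β, q)` is a pure gauge `d ψ` (`ψ` = the window antiderivative of `h` along the
`β`-coordinate), so leaf-02 g47's Ward identity `SymBorderGaugeLegContact.tsum_dz_mul_symVhSAt` replaces the second-order letter by the FIRST-ORDER (0.4) kernel `linSym04At`
against the slot data `s(u_ν)·(ψ(u + e_ν) − ψ(p + ρ + L·e_m))` (§4).  A direction-aware support lemma for an1's permuted combs `axialP σ` (§1, leaf-06's `FaceDataHessNull.lettersInB_axial`
through the pull-back `P1g`) shows that a one-form supported on the exit rows of its own bond directions is read by the symmetrised rooted averaging ONLY on the straight `L`-segment, at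
the one face bond per comb (§2–§3: `symLinAvgAt_faceForm`); there the window `ψ(t + e_m) − ψ(L·y + ρ + L·e_m)` contains no face value of `h` (§4), so the current is `0`.

NOT IN PRINT; OUR BOOKKEEPING ([folklore] finite combinatorics over an1's DEFINITIONS BY NAME: `SymAveragingHessianCounts.axialP ∕ P1g ∕ symVhSAt ∕ symLinCountAt ∕ symLinKerAt ∕
symVhKerAt_eq_zero_right ∕ symLinCountAt_eq_zero ∕ symVhSAt_symm`, `SymmetrisedAxialPotential.symLinAvgAt ∕ symAxial ∕ axialPerm`, `KernelPermutation.psite`, `DshAn1.linSym04At ∕ lin04KerAt`,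
`SymAveragingWardRootedStencils.lin04KerAt_eq_symLinKerAt`, leaf-02's `SymBorderGaugeLegContact.tsum_dz_mul_symVhSAt ∕ symVhSAt_inl_inr_eq_zero_of_not_mem`, leaf-04's
`SymVHClassCurrentSym.symLinAvgAt_eq_sum_nearBox`, `VHClassCurrentSym.sum_range_face`, `LinearGaugeVH.nearBox`, leaf-06's `FaceDataHessNull.lettersInB_axial`; 0 `def`, 0 cited fact,
0 `def … : Prop`, 0 sorry).
HONEST FRAMING (cell contract, verbatim): «discharging `BetaPertH` makes Bałaban's UV stability UNCONDITIONAL — a real constructive-QFT result; it is NOT the continuum limit and NOT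
the Clay problem.»  HONEST DEPENDENCY (verbatim): «continuum YM on T⁴ ⇐ BetaPertH ∧ nine spine estimates (0/9 proved); BetaPertH ⇐ (D1) ∧ (D4) ∧ CAP+tail; G-an2-4 gates asym, D1
and NE2/3/4.»

WHAT ([folklore]; generic `d`, `1 ≤ L`, in-block root `r ∈ box (d+1) L`): §1 `lettersInB_axialP` (the moving coordinate of every letter of a permuted comb stays strictly below the top of
its segment); §2 `axialP_sum_eq_zero_of_faceForm`, `symAxial_eq_zero_of_faceForm` (in-block combs do not read an exit-row-supported form), `segUp_sum_faceForm` (the straight segment reads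
it at its one face bond); §3 **`symLinAvgAt_faceForm`**, `sum_nearBox_faceForm_mul_symLinCountAt_eq_zero`; §4 **`symVhSAt_faceData_eq_zero`** (weighted leg first, free leg second) and
**`symVhSAt_faceData_eq_zero'`** (free leg first).  Asserts NO value of Bałaban's tables beyond an1's DEFINED kernels; NEVER «G-an2-4 closed» as (CONV-C); NOT D1, NOT `BetaPertH`, NOT
continuum, NOT Clay.  2026-08-27; no existing file touched.
-/

noncomputable section

open Finset
open scoped BigOperators Nat
open Literature.MathematicalPhysics.QuantumFieldTheory.Balaban1983to89
open Literature.MathematicalPhysics.QuantumFieldTheory.Balaban1983to89.Beta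
open AffineAveraging AveragingContours AveragingContoursRooted AveragingHessianKernels AveragingHessianKernelsRooted
open OneStepResolventKernel (Fib)
open Summit.QuantumFields.BalabanUV.Beta.KernelPermutation (psite psite_apply psite_symm_apply)
open Summit.QuantumFields.BalabanUV.Beta.SymmetrisedAxialPotential (symAxial axialPerm symLinAvgAt)
open Summit.QuantumFields.BalabanUV.Beta.SymAveragingHessianCounts (axialP axialP_sum_real P1g P1g_apply symVhSAt symVhSAt_symm symVhKerAt_eq_zero_right symLinCountAt symLinKerAt
  symLinCountAt_eq_zero)
open Summit.QuantumFields.BalabanUV.Beta.DshAn1 (linSym04At lin04KerAt linSym04At_inl_inr)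
open Summit.QuantumFields.BalabanUV.Beta.SymAveragingWardRootedStencils (lin04KerAt_eq_symLinKerAt)
open Summit.QuantumFields.BalabanUV.Beta.LinearGaugeVH (nearBox mem_nearBox)
open Summit.QuantumFields.BalabanUV.Beta.GAN24.VHClassCurrentSym (sum_range_face)
open Summit.QuantumFields.BalabanUV.Beta.GAN24.SymVHClassCurrentSym (symLinAvgAt_eq_sum_nearBox)
open Summit.QuantumFields.BalabanUV.Beta.GAN24.SymBorderGaugeLegContact (tsum_dz_mul_symVhSAt symVhSAt_inl_inr_eq_zero_of_not_mem)
open Summit.QuantumFields.BalabanUV.Beta.GAN24.FaceDataHessNull (lettersInB_axial)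

namespace Summit.QuantumFields.BalabanUV.Beta.GAN24.SymFaceDataVHNull

variable {d : ℕ}

/-! ## §1 Direction-aware letter support of the permuted combs -/

section Letters

variable {D : ℕ} {R : Type*} [AddCommGroup R]

/-- [folklore] **THE MOVING COORDINATE OF EVERY LETTER OF A PERMUTED COMB STAYS STRICTLY BELOW THE TOP OF ITS SEGMENT**: every letter of `axialP σ A y x` is `± A κ x′` with `x′` in the
coordinatewise hull of `y`, `x` and `x′_κ < max (y_κ) (x_κ)` — leaf-06's `lettersInB_axial` for the pulled-back form `P1g σ A` between the pulled-back endpoints, read back through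
`psite σ` (the region is permutation covariant). -/
theorem lettersInB_axialP (σ : Equiv.Perm (Fin D)) (A : Form1 D R) (y x : Fin D → ℤ) :
    (∀ a ∈ axialP σ A y x, ∃ κ₀ x₀, ((fun (κ : Fin D) (x' : Fin D → ℤ) => (∀ i, min (y i) (x i) ≤ x' i ∧ x' i ≤ max (y i) (x i)) ∧ x' κ < max (y κ) (x κ))) κ₀ x₀ ∧
      (a = A κ₀ x₀ ∨ a = -A κ₀ x₀)) := by
  intro a ha
  unfold SymAveragingHessianCounts.axialP at ha
  obtain ⟨κ, w, ⟨hw, hlt⟩, h⟩ := lettersInB_axial (P1g σ A) ((psite σ).symm y) ((psite σ).symm x) a ha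
  refine ⟨σ κ, psite σ w, ⟨fun i => ?_, ?_⟩, ?_⟩
  · have hi := hw (σ.symm i)
    simp only [psite_symm_apply, Equiv.apply_symm_apply] at hi
    simpa only [psite_apply] using hi
  · simp only [psite_symm_apply] at hlt
    simpa only [psite_apply, Equiv.symm_apply_apply] using hlt
  · simpa only [P1g_apply] using h

end Letters

/-! ## §2 In-block combs do not read an exit-row-supported form; the straight segment reads it at its face bond -/

section Face

variable {L : ℕ}

/-- [folklore] `(L·z + k) % L = k` for `0 ≤ k < L`. -/
theorem emod_block (z : ℤ) {k : ℤ} (hk0 : 0 ≤ k) (hkL : k < (L : ℤ)) : ((L : ℤ) * z + k) % (L : ℤ) = k := by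
  rw [add_comm, Int.add_mul_emod_self_left, Int.emod_eq_of_lt hk0 hkL]

/-- [folklore] **AN IN-BLOCK PERMUTED COMB DOES NOT READ AN EXIT-ROW-SUPPORTED FORM**: if `A κ x = 0` whenever `x_κ % L ≠ L − 1` (each component supported on the exit rows of ITS OWN
direction), then between two points of the block `B(y)` (offsets `r`, `b ∈ box`) every permuted comb sums to `0` — its letters have moving coordinate `L·y_κ ≤ x′_κ ≤ L·y_κ + L − 2` (§1). -/
theorem axialP_sum_eq_zero_of_faceForm {A : Form1 (d + 1) ℝ} (hA : ∀ (κ : Fin (d + 1)) (x : Fin (d + 1) → ℤ), x κ % (L : ℤ) ≠ (L : ℤ) - 1 → A κ x = 0)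
    (σ : Equiv.Perm (Fin (d + 1))) (y : Fin (d + 1) → ℤ) {r b : Fin (d + 1) → ℕ} (hr : r ∈ box (d + 1) L) (hb : b ∈ box (d + 1) L) :
    (axialP σ A ((L : ℤ) • y + toSite r) ((L : ℤ) • y + toSite b)).sum = 0 := by
  have hr' : ∀ i, r i < L := by simpa [AffineAveraging.box, Fintype.mem_piFinset, Finset.mem_range] using hr
  have hb' : ∀ i, b i < L := by simpa [AffineAveraging.box, Fintype.mem_piFinset, Finset.mem_range] using hb
  refine List.sum_eq_zero fun a ha => ?_
  obtain ⟨κ, x', ⟨hx', hlt⟩, h⟩ := lettersInB_axialP σ A _ _ a ha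
  have hlo := (hx' κ).1
  simp only [Pi.add_apply, Pi.smul_apply, smul_eq_mul, toSite] at hlo hlt
  have hrκ := hr' κ
  have hbκ := hb' κ
  have h0 : (L : ℤ) * y κ ≤ x' κ := by
    rcases le_total (r κ : ℤ) (b κ : ℤ) with hle | hle
    · rw [min_eq_left (by linarith)] at hlo; linarith
    · rw [min_eq_right (by linarith)] at hlo; linarith
  have h1 : x' κ < (L : ℤ) * y κ + ((L : ℤ) - 1) := by
    rcases le_total (r κ : ℤ) (b κ : ℤ) with hle | hle
    · rw [max_eq_right (by linarith)] at hlt; have : (b κ : ℤ) ≤ (L : ℤ) - 1 := by omega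
      linarith
    · rw [max_eq_left (by linarith)] at hlt; have : (r κ : ℤ) ≤ (L : ℤ) - 1 := by omega
      linarith
  have hmod : x' κ % (L : ℤ) ≠ (L : ℤ) - 1 := by
    have e : x' κ = (L : ℤ) * y κ + (x' κ - (L : ℤ) * y κ) := by ring
    rw [e, emod_block (L := L) (y κ) (by linarith) (by linarith)]
    omega
  rcases h with h | h
  · rw [h, hA κ x' hmod]
  · rw [h, hA κ x' hmod, neg_zero]

/-- [folklore] … hence the symmetrised comb integral between two points of one block vanishes on such a form. -/
theorem symAxial_eq_zero_of_faceForm {A : Form1 (d + 1) ℝ} (hA : ∀ (κ : Fin (d + 1)) (x : Fin (d + 1) → ℤ), x κ % (L : ℤ) ≠ (L : ℤ) - 1 → A κ x = 0)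
    (y : Fin (d + 1) → ℤ) {r b : Fin (d + 1) → ℕ} (hr : r ∈ box (d + 1) L) (hb : b ∈ box (d + 1) L) :
    symAxial A ((L : ℤ) • y + toSite r) ((L : ℤ) • y + toSite b) = 0 := by
  unfold SymmetrisedAxialPotential.symAxial
  refine Finset.sum_eq_zero fun σ _ => ?_
  rw [← axialP_sum_real]
  exact axialP_sum_eq_zero_of_faceForm hA σ y hr hb

/-- [folklore] **THE STRAIGHT `L`-SEGMENT READS AN EXIT-ROW-SUPPORTED FORM AT ITS ONE FACE BOND**: from the in-block point `L·y + b` in direction `m`,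
`Σ_{s<L} A m (L·y + b + s·e_m) = A m (the point with m-coordinate L·y_m + L − 1, other coordinates L·y_i + b_i)`. -/
theorem segUp_sum_faceForm (hL : 1 ≤ L) {A : Form1 (d + 1) ℝ} (hA : ∀ (κ : Fin (d + 1)) (x : Fin (d + 1) → ℤ), x κ % (L : ℤ) ≠ (L : ℤ) - 1 → A κ x = 0)
    (m : Fin (d + 1)) (y : Fin (d + 1) → ℤ) {b : Fin (d + 1) → ℕ} (hb : b ∈ box (d + 1) L) :
    (segUp A ((L : ℤ) • y + toSite b) m L).sum = A m (fun i => if i = m then (L : ℤ) * y m + ((L : ℤ) - 1) else (L : ℤ) * y i + (b i : ℤ)) := by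
  have hb' : ∀ i, b i < L := by simpa [AffineAveraging.box, Fintype.mem_piFinset, Finset.mem_range] using hb
  set g : ℤ → ℝ := fun n => A m (fun i => if i = m then n else (L : ℤ) * y i + (b i : ℤ)) with hg
  have hgsupp : ∀ n : ℤ, n % (L : ℤ) ≠ (L : ℤ) - 1 → g n = 0 := by
    intro n hn
    exact hA m _ (by simpa using hn)
  have hpt : ∀ s : ℕ, A m ((L : ℤ) • y + toSite b + (s : ℤ) • unitVec m) = g ((L : ℤ) * y m + (b m : ℤ) + (s : ℤ)) := by
    intro s
    rw [hg]
    congr 1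
    funext i
    by_cases hi : i = m
    · subst hi
      simp [toSite, unitVec_apply]
    · simp [toSite, unitVec_apply, hi]
  rw [segUp_sum]
  simp_rw [hpt]
  rw [sum_range_face hL (hb' m) g hgsupp (y m)]

/-! ## §3 The symmetrised rooted averaging of an exit-row-supported form -/

/-- [folklore] **THE SYMMETRISED ROOTED AVERAGING OF AN EXIT-ROW-SUPPORTED FORM IS `(d+1)!` TIMES THE SUM OVER THE BLOCK OF ITS VALUE AT THE SEGMENT's FACE BOND** (coarse bond
`(m, y)`, in-block root `r`): the two in-block combs contribute nothing (§2). -/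
theorem symLinAvgAt_faceForm (hL : 1 ≤ L) {r : Fin (d + 1) → ℕ} (hr : r ∈ box (d + 1) L) {A : Form1 (d + 1) ℝ}
    (hA : ∀ (κ : Fin (d + 1)) (x : Fin (d + 1) → ℤ), x κ % (L : ℤ) ≠ (L : ℤ) - 1 → A κ x = 0) (m : Fin (d + 1)) (y : Fin (d + 1) → ℤ) :
    symLinAvgAt (toSite r) A L m y = ((d + 1) ! : ℝ) * ∑ b ∈ box (d + 1) L, A m (fun i => if i = m then (L : ℤ) * y m + ((L : ℤ) - 1) else (L : ℤ) * y i + (b i : ℤ)) := by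
  unfold SymmetrisedAxialPotential.symLinAvgAt
  rw [Finset.mul_sum]
  refine Finset.sum_congr rfl fun b hb => ?_
  have e1 : (L : ℤ) • y + toSite r + (L : ℤ) • unitVec m = (L : ℤ) • (y + unitVec m) + toSite r := by rw [smul_add]; abel
  have e2 : (L : ℤ) • y + toSite b + (L : ℤ) • unitVec m = (L : ℤ) • (y + unitVec m) + toSite b := by rw [smul_add]; abel
  rw [symAxial_eq_zero_of_faceForm hA y hr hb, e1, e2, symAxial_eq_zero_of_faceForm hA (y + unitVec m) hr hb, segUp_sum_faceForm hL hA m y hb]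
  ring

/-- [folklore] **AN EXIT-ROW-SUPPORTED SLOT DATUM THAT VANISHES ON THE SEGMENT's FACE BONDS HAS ZERO (0.4) FIRST-ORDER CURRENT**: for `G` supported on `{u : u_ν % L = L − 1}` and vanishing at
the face points of the block `B(y)` in direction `m` when `ν = m`, `Σ_{u ∈ nearBox L y} G u · LIN_sym_{(m,y)}(ν, u) = 0` (leaf-04's kernel representation `symLinAvgAt_eq_sum_nearBox` of §3). -/
theorem sum_nearBox_faceForm_mul_symLinCountAt_eq_zero (hL : 1 ≤ L) {r : Fin (d + 1) → ℕ} (hr : r ∈ box (d + 1) L) (ν m : Fin (d + 1)) (y : Fin (d + 1) → ℤ)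
    {G : (Fin (d + 1) → ℤ) → ℝ} (hG1 : ∀ u : Fin (d + 1) → ℤ, u ν % (L : ℤ) ≠ (L : ℤ) - 1 → G u = 0)
    (hG2 : ν = m → ∀ b ∈ box (d + 1) L, G (fun i => if i = m then (L : ℤ) * y m + ((L : ℤ) - 1) else (L : ℤ) * y i + (b i : ℤ)) = 0) :
    ∑ u ∈ nearBox L y, G u * (symLinCountAt (toSite r) L m y (ν, u) : ℝ) = 0 := by
  classical
  have hA : ∀ (κ : Fin (d + 1)) (x : Fin (d + 1) → ℤ), x κ % (L : ℤ) ≠ (L : ℤ) - 1 → (fun κ u => if κ = ν then G u else 0) κ x = 0 := by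
    intro κ x hx
    by_cases hκ : κ = ν
    · subst hκ; simp only [if_true]; exact hG1 x hx
    · simp only [if_neg hκ]
  have e := symLinAvgAt_eq_sum_nearBox hr (fun κ u => if κ = ν then G u else 0) m y
  rw [symLinAvgAt_faceForm hL hr hA m y] at e
  have hrhs : ∑ x ∈ nearBox L y, ∑ κ : Fin (d + 1), (symLinCountAt (toSite r) L m y (κ, x) : ℝ) * (fun κ u => if κ = ν then G u else 0) κ x =
      ∑ u ∈ nearBox L y, G u * (symLinCountAt (toSite r) L m y (ν, u) : ℝ) := by
    refine Finset.sum_congr rfl fun x _ => ?_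
    rw [Finset.sum_eq_single ν (fun κ _ hκ => by simp only [if_neg hκ, mul_zero]) (fun h => absurd (Finset.mem_univ ν) h)]
    simp only [if_true]
    ring
  have hlhs : ((d + 1) ! : ℝ) * ∑ b ∈ box (d + 1) L, (fun κ u => if κ = ν then G u else 0) m (fun i => if i = m then (L : ℤ) * y m + ((L : ℤ) - 1) else (L : ℤ) * y i + (b i : ℤ)) = 0 := by
    refine mul_eq_zero_of_right _ (Finset.sum_eq_zero fun b hb => ?_)
    by_cases hm : m = ν
    · beta_reduce
      rw [if_pos hm]
      exact hG2 hm.symm b hb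
    · beta_reduce
      rw [if_neg hm]
  rw [← hrhs, ← e, hlhs]

end Face

/-! ## §4 The symmetrised border letter against face data on both legs -/

section Letter

variable {L : ℕ}

/-- [folklore] A window of length `< L` starting at a block corner carries no face value of a face-supported profile: `Σ_{k<c} h(L·z + k) = 0` for `c < L`. -/
theorem sum_range_window_eq_zero {h : ℤ → ℝ} (hh : ∀ n : ℤ, n % (L : ℤ) ≠ (L : ℤ) - 1 → h n = 0) (z : ℤ) {c : ℕ} (hc : c < L) :
    ∑ k ∈ Finset.range c, h ((L : ℤ) * z + (k : ℤ)) = 0 := by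
  refine Finset.sum_eq_zero fun k hk => hh _ ?_
  have hk' : k < c := Finset.mem_range.1 hk
  rw [emod_block (L := L) z (by positivity) (by exact_mod_cast (hk'.trans hc))]
  have : (k : ℤ) < (L : ℤ) - 1 := by
    have : k + 1 < L := by omega
    omega
  exact ne_of_lt this

/-- [folklore] `symVhSAt`'s `(inl, inr)` entry vanishes unless the SLOT site lies in the support box of the multiplier leg's block (`symVhKerAt_eq_zero_right` through the packer). -/
theorem symVhSAt_inl_inr_eq_zero_of_not_near_slot {r : Fin (d + 1) → ℕ} (hr : r ∈ box (d + 1) L) (κ' : Fin (d + 1)) {u : Fin (d + 1) → ℤ} (q p : Fin (d + 1) → ℤ)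
    (α μ : Fin (d + 1)) (hu : ¬ Near L (blk L p) u) :
    symVhSAt (toSite r) d L rfl κ' u q p (Sum.inl α) (Sum.inr μ) = 0 := by
  simp only [symVhSAt, packVH_inl_inr]
  split_ifs
  · exact symVhKerAt_eq_zero_right hr _ (f' := (κ', u)) hu
  · rfl

/-- NOT IN PRINT; OUR BOOKKEEPING.  **THE SYMMETRISED BORDER LETTER AGAINST FACE DATA ON BOTH LEGS VANISHES (weighted leg first, free leg second)**: for exit-face-supported
single-coordinate data `h` (direction `β`, fluctuation leg) and `s` (direction `ν`, slot), `1 ≤ L`, in-block root `r ∈ box L`, every free leg `(p, a)`: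
`Σ'_q h(q_β)·Σ'_u s(u_ν)·symVhSAt ρ d L ν u q p (inl β) a = 0` — the exact sym twin of leaf-06's `FaceDataVHNull.vhSAt_faceData_eq_zero`. -/
theorem symVhSAt_faceData_eq_zero (hL : 1 ≤ L) {r : Fin (d + 1) → ℕ} (hr : r ∈ box (d + 1) L) (ν β : Fin (d + 1))
    {h s : ℤ → ℝ} (hh : ∀ n : ℤ, n % (L : ℤ) ≠ (L : ℤ) - 1 → h n = 0) (hs : ∀ n : ℤ, n % (L : ℤ) ≠ (L : ℤ) - 1 → s n = 0)
    (p : Fin (d + 1) → ℤ) (a : Fib d) :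
    ∑' q : Fin (d + 1) → ℤ, h (q β) * ∑' u : Fin (d + 1) → ℤ, s (u ν) * symVhSAt (toSite r) d L rfl ν u q p (Sum.inl β) a = 0 := by
  classical
  rcases a with α | m
  · simp [symVhSAt]
  · by_cases hp : off L p = 0
    swap
    · simp only [symVhSAt, packVH_inl_inr, if_neg hp, mul_zero, tsum_zero]
    set y : Fin (d + 1) → ℤ := blk L p with hy
    have hpy : p = (L : ℤ) • y := eq_smul_blk_of_off_eq_zero hL hp
    -- supports: the fluctuation leg and the slot both lie in the support box
    have hVq : ∀ (q : Fin (d + 1) → ℤ), q ∉ nearBox L y → ∀ (u : Fin (d + 1) → ℤ) (α' : Fin (d + 1)),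
        symVhSAt (toSite r) d L rfl ν u q p (Sum.inl α') (Sum.inr m) = 0 :=
      fun q hq u α' => symVhSAt_inl_inr_eq_zero_of_not_mem hr ν u p α' m (by rwa [← hy])
    have hVu : ∀ (u : Fin (d + 1) → ℤ), u ∉ nearBox L y → ∀ (q : Fin (d + 1) → ℤ) (α' : Fin (d + 1)),
        symVhSAt (toSite r) d L rfl ν u q p (Sum.inl α') (Sum.inr m) = 0 :=
      fun u hu q α' => symVhSAt_inl_inr_eq_zero_of_not_near_slot hr ν q p α' m (by rw [← hy]; exact fun hn => hu (mem_nearBox.2 hn))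
    -- the window antiderivative of `h` along `β`, based at the block corner
    set ψ : (Fin (d + 1) → ℤ) → ℝ := fun z => ∑ k ∈ Finset.range (z β - (L : ℤ) * y β).toNat, h ((L : ℤ) * y β + (k : ℤ)) with hψ
    have hdz : ∀ q ∈ nearBox L y, ∀ α' : Fin (d + 1), dz ψ α' q = if α' = β then h (q β) else 0 := by
      intro q hq α'
      have hqβ : (L : ℤ) * y β ≤ q β := ((mem_nearBox.1 hq) β).1
      show ψ (q + unitVec α') - ψ q = _
      by_cases hα : α' = β
      · subst hα
        rw [if_pos rfl, hψ]
        simp only [Pi.add_apply, unitVec_apply, if_true]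
        rw [show (q α' + 1 - (L : ℤ) * y α').toNat = (q α' - (L : ℤ) * y α').toNat + 1 by omega, Finset.sum_range_succ, add_sub_cancel_left]
        congr 1
        omega
      · rw [if_neg hα, hψ]
        simp only [Pi.add_apply, unitVec_apply, if_neg (Ne.symm hα), add_zero, sub_self]
    -- pointwise: the face weight on the fluctuation leg is the pure gauge `dψ`
    have hpoint : ∀ (u q : Fin (d + 1) → ℤ), ∑ α' : Fin (d + 1), dz ψ α' q * symVhSAt (toSite r) d L rfl ν u q p (Sum.inl α') (Sum.inr m) =
        h (q β) * symVhSAt (toSite r) d L rfl ν u q p (Sum.inl β) (Sum.inr m) := by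
      intro u q
      by_cases hq : q ∈ nearBox L y
      · rw [Finset.sum_eq_single β (fun α' _ hα' => by rw [hdz q hq α', if_neg hα', zero_mul]) (fun h => absurd (Finset.mem_univ β) h), hdz q hq β, if_pos rfl]
      · rw [hVq q hq u β, mul_zero]
        exact Finset.sum_eq_zero fun α' _ => by rw [hVq q hq u α', mul_zero]
    -- inner and outer sums are finite
    have hin : ∀ q : Fin (d + 1) → ℤ, (∑' u : Fin (d + 1) → ℤ, s (u ν) * symVhSAt (toSite r) d L rfl ν u q p (Sum.inl β) (Sum.inr m)) =
        ∑ u ∈ nearBox L y, s (u ν) * symVhSAt (toSite r) d L rfl ν u q p (Sum.inl β) (Sum.inr m) :=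
      fun q => tsum_eq_sum fun u hu => by rw [hVu u hu q β, mul_zero]
    simp_rw [hin]
    rw [tsum_eq_sum (s := nearBox L y) fun q hq => by
      rw [Finset.sum_eq_zero fun u _ => by rw [hVq q hq u β, mul_zero], mul_zero]]
    simp_rw [Finset.mul_sum]
    rw [Finset.sum_comm]
    have eu : ∀ u ∈ nearBox L y, ∑ q ∈ nearBox L y, h (q β) * (s (u ν) * symVhSAt (toSite r) d L rfl ν u q p (Sum.inl β) (Sum.inr m)) =
        s (u ν) * ((ψ (u + unitVec ν) - ψ (p + toSite r + (L : ℤ) • unitVec m)) * lin04KerAt (toSite r) L m y (ν, u)) := by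
      intro u _
      have e1 : ∑ q ∈ nearBox L y, h (q β) * (s (u ν) * symVhSAt (toSite r) d L rfl ν u q p (Sum.inl β) (Sum.inr m)) =
          s (u ν) * ∑ q ∈ nearBox L y, h (q β) * symVhSAt (toSite r) d L rfl ν u q p (Sum.inl β) (Sum.inr m) := by
        rw [Finset.mul_sum]
        exact Finset.sum_congr rfl fun q _ => by ring
      have e2 : ∑ q ∈ nearBox L y, h (q β) * symVhSAt (toSite r) d L rfl ν u q p (Sum.inl β) (Sum.inr m) =
          ∑' q : Fin (d + 1) → ℤ, ∑ α' : Fin (d + 1), dz ψ α' q * symVhSAt (toSite r) d L rfl ν u q p (Sum.inl α') (Sum.inr m) := by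
        rw [tsum_congr (hpoint u)]
        exact (tsum_eq_sum (s := nearBox L y) fun q hq => by rw [hVq q hq u β, mul_zero]).symm
      rw [e1, e2, tsum_dz_mul_symVhSAt hL hr ν u p m ψ, linSym04At_inl_inr, if_pos hp]
    rw [Finset.sum_congr rfl eu]
    -- the slot datum after the Ward identity
    set G : (Fin (d + 1) → ℤ) → ℝ := fun u => s (u ν) * (ψ (u + unitVec ν) - ψ (p + toSite r + (L : ℤ) • unitVec m)) with hG
    have hG1 : ∀ u : Fin (d + 1) → ℤ, u ν % (L : ℤ) ≠ (L : ℤ) - 1 → G u = 0 := fun u hu => by rw [hG]; simp only [hs _ hu, zero_mul]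
    have hr' : ∀ i, r i < L := by simpa [AffineAveraging.box, Fintype.mem_piFinset, Finset.mem_range] using hr
    have hG2 : ν = m → ∀ b ∈ box (d + 1) L, G (fun i => if i = m then (L : ℤ) * y m + ((L : ℤ) - 1) else (L : ℤ) * y i + (b i : ℤ)) = 0 := by
      intro hνm b hb
      subst hνm
      have hb' : ∀ i, b i < L := by simpa [AffineAveraging.box, Fintype.mem_piFinset, Finset.mem_range] using hb
      rw [hG]
      refine mul_eq_zero_of_right _ (sub_eq_zero.2 ?_)
      rw [hpy, hψ]
      simp only [Pi.add_apply, Pi.smul_apply, smul_eq_mul, toSite, unitVec_apply]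
      by_cases hβ : β = ν
      · subst hβ
        simp only [if_true, mul_one]
        rw [show ((L : ℤ) * y β + ((L : ℤ) - 1) + 1 - (L : ℤ) * y β).toNat = L by omega,
          show ((L : ℤ) * y β + (r β : ℤ) + (L : ℤ) - (L : ℤ) * y β).toNat = L + r β by omega, Finset.sum_range_add]
        have tail : ∑ k ∈ Finset.range (r β), h ((L : ℤ) * y β + ((L + k : ℕ) : ℤ)) = 0 := by
          have h0 := sum_range_window_eq_zero hh (y β + 1) (hr' β)
          rw [← h0]
          refine Finset.sum_congr rfl fun k _ => ?_
          congr 1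
          push_cast
          ring
        rw [tail, add_zero]
      · simp only [if_neg hβ, mul_zero, add_zero]
        rw [show ((L : ℤ) * y β + (b β : ℤ) - (L : ℤ) * y β).toNat = b β by omega,
          show ((L : ℤ) * y β + (r β : ℤ) - (L : ℤ) * y β).toNat = r β by omega,
          sum_range_window_eq_zero hh (y β) (hb' β), sum_range_window_eq_zero hh (y β) (hr' β)]
    have ekernel : ∀ u ∈ nearBox L y, s (u ν) * ((ψ (u + unitVec ν) - ψ (p + toSite r + (L : ℤ) • unitVec m)) * lin04KerAt (toSite r) L m y (ν, u)) =
        (G u * (symLinCountAt (toSite r) L m y (ν, u) : ℝ)) / ((((d + 1) ! : ℕ) : ℝ) * (L : ℝ) ^ (d + 1)) := by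
      intro u _
      rw [lin04KerAt_eq_symLinKerAt, SymAveragingHessianCounts.symLinKerAt, hG]
      ring
    rw [Finset.sum_congr rfl ekernel, ← Finset.sum_div, sum_nearBox_faceForm_mul_symLinCountAt_eq_zero hL hr ν m y hG1 hG2, zero_div]

/-- NOT IN PRINT; OUR BOOKKEEPING.  **THE SYMMETRISED BORDER LETTER AGAINST FACE DATA ON BOTH LEGS VANISHES (free leg first, weighted leg second)** (`symVhSAt_symm`) — the sym twin of
leaf-06's `FaceDataVHNull.vhSAt_faceData_eq_zero'`. -/
theorem symVhSAt_faceData_eq_zero' (hL : 1 ≤ L) {r : Fin (d + 1) → ℕ} (hr : r ∈ box (d + 1) L) (ν β : Fin (d + 1))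
    {h s : ℤ → ℝ} (hh : ∀ n : ℤ, n % (L : ℤ) ≠ (L : ℤ) - 1 → h n = 0) (hs : ∀ n : ℤ, n % (L : ℤ) ≠ (L : ℤ) - 1 → s n = 0)
    (p : Fin (d + 1) → ℤ) (a : Fib d) :
    ∑' q : Fin (d + 1) → ℤ, h (q β) * ∑' u : Fin (d + 1) → ℤ, s (u ν) * symVhSAt (toSite r) d L rfl ν u p q a (Sum.inl β) = 0 := by
  have e : ∀ (u q : Fin (d + 1) → ℤ), symVhSAt (toSite r) d L rfl ν u p q a (Sum.inl β) = symVhSAt (toSite r) d L rfl ν u q p (Sum.inl β) a :=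
    fun u q => symVhSAt_symm (toSite r) L ν u p q a (Sum.inl β)
  simp_rw [e]
  exact symVhSAt_faceData_eq_zero hL hr ν β hh hs p a

end Letter

end Summit.QuantumFields.BalabanUV.Beta.GAN24.SymFaceDataVHNull

end
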